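import Summits.ResolutionOfSingularities.ResolutionOfSingularities.Theorems.HilbertSamuelEliminationCampaignW42ThmIVOfFormallySmooth
import Summits.ResolutionOfSingularities.ResolutionOfSingularities.Theorems.HilbertSamuelEliminationCampaignW42ChartPrimeSeparable
import HarnessLib

/-!
# [OURS · L1 W4.2] Hironaka's THEOREM IV at near points with SEPARABLE ALGEBRAIC residue field extension `κ(x')/κ(x)`
# (every characteristic, `κ(x)` arbitrary): `J_D ≤ span(J_D ∩ U(𝔭_{x'}))`
# (campaign s42, cell res-hironaka; partial discharge of F-51′ `Hironaka1970_thmIV`; `--supports` stmt-ResolutionOfSingularities-17845)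

HONEST FRAMING. OURS (slot W4.2, prover res-L1-s42-pv-1, gen 7). Composition of
`normalConeIdeal_le_span_inter_multAlgebra_of_formallySmooth` (`…CampaignW42ThmIVOfFormallySmooth`: [H4] Th. IV at near points
whose cone-point residue field is formally smooth over `κ(x)`) with `formallySmooth_residueField_chartPrime_of_isSeparable`
(`…CampaignW42ChartPrimeSeparable`: this holds when `κ(x')` is separable algebraic over `κ(x)`, the point being a point of `ℙ`
by `Directrix214Sharp.exists_X_not_mem_chartPrime_of_map_eq`):

* **`normalConeIdeal_le_span_inter_multAlgebra_of_isSeparable`** — Th. IV's conclusion at every near point `x'` (any level,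
  any generators of `I_{D,x}`, any chart datum) whose residue field `κ(x')` is SEPARABLE ALGEBRAIC over `κ(x)` (through `π`);
  e.g. every `κ(x)`-rational near point, every closed point of the fibre with separable residue extension;
* **`hironaka1970_thmIV_of_isSeparable`** — the body of the named fact `Hironaka1970_thmIV` VERBATIM with the one inserted
  hypothesis «`κ(x')` separable algebraic over `κ(x)`».

With `…_of_perfectField` (all near points over perfect `κ(x)`) this leaves, of the printed Theorem IV, exactly the near points
with INSEPARABLE (or non-algebraic non-separably-generated) residue extension over an imperfect `κ(x)` — the case Dietel 2015
(9.2.7) isolates and does not prove. NOT a statement of H. Hironaka's manuscript [Hironaka2017]. AI-written; AI review is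
weaker than expert review. References (orientation): H. Hironaka, J. Math. Kyoto Univ. 10 (1970), TH. IV p. 156, (14.3)
p. 170; B. Dietel, Dissertation Regensburg (2015), (9.2.6)–(9.2.7).
-/

noncomputable section

-- single-conjunct summit: the doubled namespace component `ResolutionOfSingularities` is mandated
set_option linter.dupNamespace false

open CategoryTheory AlgebraicGeometry TopologicalSpace IsLocalRing MvPolynomial
open Literature.AlgebraicGeometry.Resolution Literature.AlgebraicGeometry.Resolution.HironakaScheme
open Literature.RingTheory.HilbertSamuel Literature.RingTheory.MvPolynomial

namespace Summit.ResolutionOfSingularities.ResolutionOfSingularities.Theorems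

namespace CampaignW42

universe u

section Schemes

variable {X X' : Scheme.{u}} [IsLocallyNoetherian X] {π : X' ⟶ X} {D : X.IdealSheafData}

/-- **[H4] THEOREM IV at a near point with separable algebraic residue field extension.** For a blow-up `π` of `X` in
`D`, permissible at `x = π x'` with `𝒪_{X,x}` universally catenary, `x'` NEAR to `x` at level `N`, generators `g` of
`I_{D,x}` and a chart datum `(t, u)` at `x'`: if `κ(x')` is separable algebraic over `κ(x)` (through `π`), then
`J_D ≤ span(J_D ∩ U(𝔭_{x'}))`. [cite: Hironaka1970NumericalCharacters, THEOREM IV p. 156 and (14.3) p. 170]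
[cite: Dietel2015, Prop. (9.2.6) p. 112–113] -/
theorem normalConeIdeal_le_span_inter_multAlgebra_of_isSeparable (hπ : IsBlowup π D) (x' : X')
    (hperm : IdealSheafData.IsPermissibleAt D (π.base x'))
    (hUC : IsUniversallyCatenaryRing (X.presheaf.stalk (π.base x'))) {N : ℕ} (hnear : IsNearPoint π N x')
    {m : ℕ} (g : Fin m → X.presheaf.stalk (π.base x')) (hg : Ideal.span (Set.range g) = stalkIdeal D (π.base x'))
    (t : X'.presheaf.stalk x') (ht : t ∈ nonZeroDivisors (X'.presheaf.stalk x'))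
    (hmap : (stalkIdeal D (π.base x')).map (π.stalkMap x').hom = Ideal.span {t})
    (u : Fin m → X'.presheaf.stalk x') (hu : ∀ i, (π.stalkMap x').hom (g i) = u i * t)
    (hsep : letI : Algebra (ResidueField (X.presheaf.stalk (π.base x'))) (ResidueField (X'.presheaf.stalk x')) :=
        (ResidueField.map (π.stalkMap x').hom).toAlgebra;
      Algebra.IsSeparable (ResidueField (X.presheaf.stalk (π.base x'))) (ResidueField (X'.presheaf.stalk x'))) :
    normalConeIdeal g ≤ Ideal.span
      ((normalConeIdeal g : Set (MvPolynomial (Fin m) (ResidueField (X.presheaf.stalk (π.base x'))))) ∩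
        (multAlgebra (ResidueField (X.presheaf.stalk (π.base x'))) (chartPrime (π.stalkMap x').hom u) :
          Set (MvPolynomial (Fin m) (ResidueField (X.presheaf.stalk (π.base x')))))) := by
  obtain ⟨i₀, hi₀⟩ :=
    SigmaMaxModificationsCorridor3.Directrix214Sharp.exists_X_not_mem_chartPrime_of_map_eq (π.stalkMap x').hom hg ht hmap hu
  exact normalConeIdeal_le_span_inter_multAlgebra_of_formallySmooth hπ x' hperm hUC hnear g hg t ht hmap u hu
    (formallySmooth_residueField_chartPrime_of_isSeparable (π.stalkMap x').hom u i₀ hi₀ hsep)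

end Schemes

/-! ## The statement of `Hironaka1970_thmIV`, verbatim, with the one added hypothesis «`κ(x')/κ(x)` separable algebraic» -/

section Verbatim

/-- **`Hironaka1970_thmIV` at separable algebraic points** — the body of the named fact
`Literature.AlgebraicGeometry.Resolution.Hironaka1970_thmIV` with its binders in the same order and ONE inserted hypothesis,
`Algebra.IsSeparable κ(x) κ(x')` for the algebra structure of `π`; PROVED.
[cite: Hironaka1970NumericalCharacters, THEOREM IV p. 156 and (14.3) p. 170] -/
theorem hironaka1970_thmIV_of_isSeparable :
    ∀ (X X' : Scheme.{u}) [IsLocallyNoetherian X] (π : X' ⟶ X) (D : X.IdealSheafData) (N : ℕ)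
      (x' : X') (x : X),
      Scheme.IsExcellent X → IdealSheafData.IsPermissible D → IsBlowup π D →
      topologicalKrullDim ↥X ≤ (N : WithBot ℕ∞) → π.base x' = x → x ∈ (D.support : Set X) →
      Scheme.hsFun X' N x' = Scheme.hsFun X N x →
      (letI : Algebra (ResidueField (X.presheaf.stalk (π.base x'))) (ResidueField (X'.presheaf.stalk x')) :=
          (ResidueField.map (π.stalkMap x').hom).toAlgebra;
        Algebra.IsSeparable (ResidueField (X.presheaf.stalk (π.base x'))) (ResidueField (X'.presheaf.stalk x'))) →
      ∀ (m : ℕ) (g : Fin m → X.presheaf.stalk (π.base x'))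
        (t : X'.presheaf.stalk x') (u : Fin m → X'.presheaf.stalk x'),
        Ideal.span (Set.range g) = stalkIdeal D (π.base x') →
        (stalkIdeal D (π.base x')).spanFinrank = m →
        t ∈ nonZeroDivisors (X'.presheaf.stalk x') →
        (stalkIdeal D (π.base x')).map (π.stalkMap x').hom = Ideal.span {t} →
        (∀ i, (π.stalkMap x').hom (g i) = u i * t) →
          normalConeIdeal g ≤ Ideal.span
            ((normalConeIdeal g : Set (MvPolynomial (Fin m) (ResidueField (X.presheaf.stalk (π.base x'))))) ∩
              (HironakaScheme.multAlgebra (ResidueField (X.presheaf.stalk (π.base x')))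
                (_root_.Literature.RingTheory.HilbertSamuel.chartPrime (π.stalkMap x').hom u) :
                Set (MvPolynomial (Fin m) (ResidueField (X.presheaf.stalk (π.base x')))))) := by
  intro X X' _ π D N x' x hexc hperm hπ _hdim hx hxD hnear hsep m g t u hgI _hm ht hmap hu
  subst hx
  exact normalConeIdeal_le_span_inter_multAlgebra_of_isSeparable hπ x' (hperm _ hxD)
    (hexc.isUniversallyCatenaryRing_stalk _) hnear g hgI t ht hmap u hu hsep

end Verbatim

end CampaignW42

end Summit.ResolutionOfSingularities.ResolutionOfSingularities.Theorems

end
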